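import Summits.BirchSwinnertonDyer.BirchSwinnertonDyer.Theorems.QuadraticBranchSignedControlPlusEtaNonsurjCongruentAnchorByName
import Summits.BirchSwinnertonDyer.BirchSwinnertonDyer.Theorems.QuadraticBranchSignedControlPlusEtaNonsurjPrimeLFunctionRecordShape
import HarnessLib

/-!
# Route `QuadraticBranchSignedControl` (rung K8, cell `bsd-potss`), residual crux
# `PlusEtaMainConjectureNonsurj` (stmt-BirchSwinnertonDyer-19606): the PRIME-`L`-FUNCTION ROAD's anchored
# rank-`≥ 1` theorems and the rank-`1` RECORD SHAPE, BY NAME — Hatley–Lei Thm. 4.6 as the landed fact `h46`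
# (seat `bsd-potss-k8eta-c2` g5, file 2)

WHAT. Seat g4's `EtaPrimeRoad` §3 (`…PrimeLFunctionRows.lean`) and record shape
(`…PrimeLFunctionRecordShape.lean`) settle a rank-`≥ 1` row with `(L_p⁺(V,η,X)) = (X)` from a congruent anchor
with `μ = 0` / a congruent CM UNIT-row anchor, the Hatley–Lei transfer being DISPLAYED (`hHL`). With the fact
landed (wi-78102) and file 1's `EtaCongruentAnchorByName.hHL_of_thm46`, this file re-issues them with `hHL`
replaced by the NAMED fact `h46 : HatleyLei2019.thm46_etaSignedMu_eq_zero_iff_of_torsionIso` (Kobayashi's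
Thm. 2.2 at `η`, `h22`, is already among their hypotheses):

* §1 `quadraticBranchPlusEtaMainConjectureAt_of_modPCongruent_of_span_eq_span_X` /
  `…_of_modPCongruent_unitRow_of_span_eq_span_X` (any anchor with `μ = 0` / a unit-row anchor);
* §2 `etaMC_r1_of_cmUnitAnchor` / `etaMC_r1_of_cmUnitAnchor_of_ainvs` (the record shape: CM unit anchor with
  `r_an(W′) = 0`, `p ∤ #Ш(W′)_an`; row `r_an(W) = 1`; per-row displayed inputs = the Kraus–Oesterlé congruence
  `ModPCongruent V′ V p` and the PARI shape `(L_p⁺(V,η,X)) = (X)` ONLY).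

So the 9 unit-anchored non-CM rank-`1` rows of 19606 below `5·10⁵` (file 3 of this seat, records by name) are
settled per row modulo NAMED PUBLISHED FACTS (`h22`, `h41`, `h46`, `hmod`, `hGZK`, `hS28`) + two displayed
per-row certificates (congruence, shape) + Cremona's displayed `r_an` — the transfer is no longer displayed.

HONEST FRAMING (cell `bsd-potss`; HUMAN RULING D-0036/D-0074): BOOKKEEPING THEOREMS ONLY — no definition, no
new fact, no `sorry`, axioms standard; CONDITIONAL on the named facts in hypothesis position; the per-row
congruence / shape inputs are numerically certified (kit j270714 / PARI), not kernel-checked. 19606 stays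
OPEN; nothing is booked; no label / mark / count moves. `--supports stmt-BirchSwinnertonDyer-19606`.

References: [HatleyLei2019] Thm. 4.6 (§4.2); [Kobayashi2003] Thm. 2.2 (p. 5), §4 + Thm. 4.1 (p. 8);
[GreenbergVatsal2000] p. 2 (2), Thm. (1.4); [BurungaleFlach2024] Thm. 1.1, Cor. 2; [KrausOesterle1992]
Prop. 4; [GreenbergLNM1716] §3 Prop. 3.8, §4 Lemma 4.2; [Cremona1997] Table 1; [SilvermanAEC2009] App. C §11.
-/

set_option autoImplicit false
set_option linter.dupNamespace false

noncomputable section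

open scoped Classical

open CongruenceSubgroup Field Function NumberField IsDedekindDomain WeierstrassCurve
open Literature.NumberTheory.EllipticCurves
open Literature.NumberTheory.EllipticCurves.ModularForms
open Literature.NumberTheory.EllipticCurves.Rank1Residual
open Literature.NumberTheory.EllipticCurves.Rank1Residual.Typed
open Literature.NumberTheory.EllipticCurves.Rank1Residual.X11RankOneCertificates
open Literature.NumberTheory.GaloisRepresentations
open Literature.NumberTheory.GaloisCohomology
open Literature.NumberTheory.EllipticCurves.IwasawaAlgebra
open Literature.NumberTheory.EllipticCurves.IwasawaDual ZpExtension
open Literature.NumberTheory.EllipticCurves.GreenbergVatsal2000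
open Summit.BirchSwinnertonDyer.Rank1Residual.X11b.Levels
open Summit.BirchSwinnertonDyer.Rank1Residual.X11b
open Summit.BirchSwinnertonDyer.Rank1Residual.Additive
open Summit.BirchSwinnertonDyer.Rank1Residual.Additive.SignedTwist
open scoped ContRepresentation
open Summit.BirchSwinnertonDyer.Rank1Residual.AdditivePotMult
open Summit.BirchSwinnertonDyer.Rank1Residual.O6 (ModPCongruent)

namespace Summit.BirchSwinnertonDyer.BirchSwinnertonDyer.Theorems

namespace EtaPrimeRoadByName

variable (p : ℕ) [hp : Fact p.Prime]

/-! ## §1 The rank-`≥ 1` rows with a congruent anchor, by name -/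

/-- **(C1⁺_η)(V,p) on a rank-`≥ 1` row with `(L_p⁺(V,η,X)) = (X)` FROM A CONGRUENT ANCHOR with `μ = 0`, BY
NAME** (= `EtaPrimeRoad.quadraticBranchPlusEtaMainConjectureAt_of_modPCongruent_of_span_eq_span_X` with `hHL` :=
`EtaCongruentAnchorByName.hHL_of_thm46`): `W` the `p*`-twist partner of the globally minimal good `a_p = 0` curve
`V` (`C • W^{(p*)} = V`, `p ≥ 5`), `Sel_{p^∞}(W/ℚ)` infinite; an anchor `V′` (globally minimal, good, `a_p(V′) = 0`,
`V′[p] ≅ V[p]`) with `μ(X⁺(V′/K_∞)^η) = 0` for every `η`-datum (displayed); the SHAPE `(Lη) = (X)` (displayed);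
named facts `h22`, `h41`, `h46`. CONDITIONAL; nothing booked.
[cite: HatleyLei2019, Thm. 4.6 (§4.2)] [cite: Kobayashi2003, §4 Even main conjecture and Thm. 4.1 (p. 8)]
[cite: GreenbergVatsal2000, p. 2 (2) and Thm. (1.4)] -/
theorem quadraticBranchPlusEtaMainConjectureAt_of_modPCongruent_of_span_eq_span_X
    (h22 : Kobayashi2003.thm22_etaSignedSelmerDual_finite_torsion)
    (h41 : Kobayashi2003.thm41_plusEtaCharIdeal_dvd)
    (h46 : HatleyLei2019.thm46_etaSignedMu_eq_zero_iff_of_torsionIso)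
    (V' : WeierstrassCurve ℚ) [V'.IsElliptic] [V'.IsGloballyMinimal]
    (V : WeierstrassCurve ℚ) [V.IsElliptic] [V.IsGloballyMinimal]
    (W : WeierstrassCurve ℚ) [W.IsElliptic] (C : VariableChange ℚ)
    (hp5 : 5 ≤ p) (hgood' : V'.HasGoodReductionAtPrime p) (hap' : V'.frobeniusTrace p = 0)
    (hμ' : ∀ (K₀ : Type) [Field K₀] [NumberField K₀] [IsCyclotomicExtension {p} ℚ K₀]
        [(galRange (K := ℚ) K₀).Normal] (ηq : absoluteGaloisGroup ℚ →* ℤˣ),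
        (∀ σ ∈ galRange (K := ℚ) K₀, ηq σ = 1) → ηq ≠ 1 →
      ∀ (κ : ZpExtension ℚ p) (γ : absoluteGaloisGroup ℚ),
        κ.IsCyclotomic → κ.IsTopGenerator γ → γ ∈ galRange (K := ℚ) K₀ →
      ∀ (D : EtaSignedSelmerDualData V' κ K₀ ℚ_[p] ηq γ 1) (g : IwasawaAlgebra p),
        D.charIdeal = Ideal.span {g} → HasUnitContent g)
    (hCV : C • W.quadraticTwist ((-1) ^ (p / 2) * p) = V)
    (hgood : V.HasGoodReductionAtPrime p) (hap : V.frobeniusTrace p = 0) (hcong : ModPCongruent V' V p)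
    (hinf : ¬ Finite ↥(W.selmerGroupPInfty p))
    (hX : ∀ {N : ℕ} [NeZero N] {f : CuspForm (Gamma0 N) 2}, IsNewformOf V f →
      ∀ (ϖ : ℚ), (if Even (p / 2) then (ϖ : ℝ) * V.realPeriodRat = plusPeriod f
          else (ϖ : ℝ) * V.imaginaryPeriodRat = minusPeriod f) →
      ∀ (Lη : IwasawaAlgebra p), IsQuadraticBranchPlusLFunction f p ϖ Lη →
        Ideal.span {Lη} = Ideal.span {(PowerSeries.X : IwasawaAlgebra p)}) :
    QuadraticBranchPlusEtaMainConjectureAt V p :=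
  EtaPrimeRoad.quadraticBranchPlusEtaMainConjectureAt_of_modPCongruent_of_span_eq_span_X p h22 h41
    (EtaCongruentAnchorByName.hHL_of_thm46 p h46 h22) V' V W C hp5 hgood' hap' hμ' hCV hgood hap hcong hinf hX

/-- **(C1⁺_η)(V,p) on an analytic-rank-`1` row with `(L_p⁺(V,η,X)) = (X)` FROM A CONGRUENT UNIT-ROW ANCHOR, BY
NAME** (= `EtaPrimeRoad.…_of_modPCongruent_unitRow_of_span_eq_span_X` with `hHL` := `hHL_of_thm46`): the anchor
`V′` is a globally minimal model of `W′^{(p*)}`, good at `p` with `a_p(V′) = 0`, with `Sel_{p^∞}(W′/ℚ) = 0` and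
`p ∤ Tam(W′)` (so `μ(X⁺(V′/K_∞)^η) = 0` is seat g2's THEOREM); `V′[p] ≅ V[p]`; `r_an(W) = 1` (so `Sel_{p^∞}(W/ℚ)` is
infinite by GZK); the shape `(Lη) = (X)` displayed; named facts `h22`, `h41`, `hGZK`, `h46`. The shape of the 9
unit-anchored non-CM rank-`1` rows of 19606 below `5·10⁵`; per row the remaining inputs are a Kraus–Oesterlé
certificate of `ModPCongruent V′ V 5` (kit j270714), PARI's `(λ,μ) = (1,0)` for `L_5⁺(V,η,X)` and Cremona's
`r_an(W) = 1`, `Sel_{5^∞}(W′/ℚ) = 0`, `5 ∤ Tam(W′)` — Hatley–Lei Thm. 4.6 is now the NAMED fact `h46`.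
CONDITIONAL; nothing booked. [cite: HatleyLei2019, Thm. 4.6 (§4.2)]
[cite: Kobayashi2003, §4 Even main conjecture and Thm. 4.1 (p. 8)] [cite: KrausOesterle1992, Prop. 4]
[cite: GreenbergLNM1716, §3 Prop. 3.8, §4 Lemma 4.2] -/
theorem quadraticBranchPlusEtaMainConjectureAt_of_modPCongruent_unitRow_of_span_eq_span_X
    (h22 : Kobayashi2003.thm22_etaSignedSelmerDual_finite_torsion)
    (h41 : Kobayashi2003.thm41_plusEtaCharIdeal_dvd)
    (hGZK : rank_eq_analyticRank_of_analyticRank_le_one)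
    (h46 : HatleyLei2019.thm46_etaSignedMu_eq_zero_iff_of_torsionIso)
    (V' : WeierstrassCurve ℚ) [V'.IsElliptic] [V'.IsGloballyMinimal]
    (W' : WeierstrassCurve ℚ) [W'.IsElliptic] [W'.IsGloballyMinimal] (C' : VariableChange ℚ)
    (V : WeierstrassCurve ℚ) [V.IsElliptic] [V.IsGloballyMinimal]
    (W : WeierstrassCurve ℚ) [W.IsElliptic] (C : VariableChange ℚ)
    (hp5 : 5 ≤ p) (hCV' : C' • W'.quadraticTwist ((-1) ^ (p / 2) * p) = V')
    (hgood' : V'.HasGoodReductionAtPrime p) (hap' : V'.frobeniusTrace p = 0)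
    (hSel' : W'.selmerGroupPInfty p = ⊥) (hTam' : ¬ p ∣ W'.tamagawaProduct)
    (hCV : C • W.quadraticTwist ((-1) ^ (p / 2) * p) = V)
    (hgood : V.HasGoodReductionAtPrime p) (hap : V.frobeniusTrace p = 0) (hcong : ModPCongruent V' V p)
    (h1 : W.analyticRank = 1)
    (hX : ∀ {N : ℕ} [NeZero N] {f : CuspForm (Gamma0 N) 2}, IsNewformOf V f →
      ∀ (ϖ : ℚ), (if Even (p / 2) then (ϖ : ℝ) * V.realPeriodRat = plusPeriod f
          else (ϖ : ℝ) * V.imaginaryPeriodRat = minusPeriod f) →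
      ∀ (Lη : IwasawaAlgebra p), IsQuadraticBranchPlusLFunction f p ϖ Lη →
        Ideal.span {Lη} = Ideal.span {(PowerSeries.X : IwasawaAlgebra p)}) :
    QuadraticBranchPlusEtaMainConjectureAt V p :=
  EtaPrimeRoad.quadraticBranchPlusEtaMainConjectureAt_of_modPCongruent_unitRow_of_span_eq_span_X p h22 h41 hGZK
    (EtaCongruentAnchorByName.hHL_of_thm46 p h46 h22) V' W' C' V W C hp5 hCV' hgood' hap' hSel' hTam' hCV hgood
    hap hcong h1 hX

/-! ## §2 The rank-`1` record shape, by name -/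

/-- **RECORD SHAPE, BY NAME — (C1⁺_η)(V,p) on a rank-`1` row from a CM UNIT ANCHOR** (=
`EtaPrimeRoad.etaMC_r1_of_cmUnitAnchor` with `hHL` := `hHL_of_thm46`). Named facts `h22`, `h41` (Kobayashi
Thm. 2.2 / Thm. 4.1 rational clause at `η`), `hmod`, `hGZK`, `hS28` (Burungale–Flach), `h46` (Hatley–Lei
Thm. 4.6); the ANCHOR `W′`: globally minimal, CM, `r_an(W′) = 0`, `#Ш(W′)_an = s′` with `p ∤ s′` (Cremona,
displayed); the ROW `W`: `r_an(W) = 1` (displayed). Then for EVERY globally minimal `V′` with `C′ • W′^{(p*)} = V′`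
and `V` with `C • W^{(p*)} = V`, both good at `p` with `a_p = 0`, IF `V′[p] ≅ V[p]` (displayed — Kraus–Oesterlé
certificate per row) and `(L_p⁺(V,η,X)) = (X)` (displayed — PARI `(λ,μ) = (1,0)` + `L(W,1) = 0`), THEN
`QuadraticBranchPlusEtaMainConjectureAt V p`. CONDITIONAL; per row; nothing booked.
[cite: HatleyLei2019, Thm. 4.6 (§4.2)] [cite: Kobayashi2003, §4 Even main conjecture and Thm. 4.1 (p. 8)]
[cite: BurungaleFlach2024, Thm 1.1 and Cor. 2] [cite: KrausOesterle1992, Prop. 4] [cite: Cremona1997, Table 1] -/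
theorem etaMC_r1_of_cmUnitAnchor
    (h22 : Kobayashi2003.thm22_etaSignedSelmerDual_finite_torsion)
    (h41 : Kobayashi2003.thm41_plusEtaCharIdeal_dvd)
    (hmod : hasEntireLFunction_rat) (hGZK : rank_eq_analyticRank_of_analyticRank_le_one)
    (hS28 : bsdTriple_of_hasCM_of_L_one_ne_zero)
    (h46 : HatleyLei2019.thm46_etaSignedMu_eq_zero_iff_of_torsionIso) (hp5 : 5 ≤ p)
    (W' : WeierstrassCurve ℚ) [W'.IsElliptic] [W'.IsGloballyMinimal] (hCM' : W'.HasCM)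
    (hr' : W'.analyticRank = 0) {s' : ℕ} (hs' : shaAn W' = (s' : ℂ)) (hps' : ¬ p ∣ s')
    (W : WeierstrassCurve ℚ) [W.IsElliptic] (hr : W.analyticRank = 1)
    (V' : WeierstrassCurve ℚ) [V'.IsElliptic] [V'.IsGloballyMinimal] (C' : VariableChange ℚ)
    (hCV' : C' • W'.quadraticTwist ((-1) ^ (p / 2) * p) = V')
    (hgood' : V'.HasGoodReductionAtPrime p) (hap' : V'.frobeniusTrace p = 0)
    (V : WeierstrassCurve ℚ) [V.IsElliptic] [V.IsGloballyMinimal] (C : VariableChange ℚ)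
    (hCV : C • W.quadraticTwist ((-1) ^ (p / 2) * p) = V)
    (hgood : V.HasGoodReductionAtPrime p) (hap : V.frobeniusTrace p = 0) (hcong : ModPCongruent V' V p)
    (hX : ∀ {N : ℕ} [NeZero N] {f : CuspForm (Gamma0 N) 2}, IsNewformOf V f →
      ∀ (ϖ : ℚ), (if Even (p / 2) then (ϖ : ℝ) * V.realPeriodRat = plusPeriod f
          else (ϖ : ℝ) * V.imaginaryPeriodRat = minusPeriod f) →
      ∀ (Lη : IwasawaAlgebra p), IsQuadraticBranchPlusLFunction f p ϖ Lη →
        Ideal.span {Lη} = Ideal.span {(PowerSeries.X : IwasawaAlgebra p)}) :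
    QuadraticBranchPlusEtaMainConjectureAt V p :=
  EtaPrimeRoad.etaMC_r1_of_cmUnitAnchor p h22 h41 hmod hGZK hS28 hp5
    (EtaCongruentAnchorByName.hHL_of_thm46 p h46 h22) W' hCM' hr' hs' hps' W hr V' C' hCV' hgood' hap' V C hCV
    hgood hap hcong hX

/-- **RECORD SHAPE, literal-anchor form, BY NAME** (= `EtaPrimeRoad.etaMC_r1_of_cmUnitAnchor_of_ainvs` with `hHL`
:= `hHL_of_thm46`; consumed by this seat's records-by-name file): the anchor a LITERAL integer equation
`W′ = ⟨b₁,…,b₆⟩` (elliptic and globally minimal: instance binders) whose CM is DECIDED in the kernel from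
`j = c₄³/Δ ∈` the thirteen CM values (`hj'`). CONDITIONAL; per row; nothing booked.
[cite: HatleyLei2019, Thm. 4.6 (§4.2)] [cite: Kobayashi2003, §4 Even main conjecture and Thm. 4.1 (p. 8)]
[cite: SilvermanAEC2009, App. C §11] [cite: Cremona1997, Table 1] -/
theorem etaMC_r1_of_cmUnitAnchor_of_ainvs
    (h22 : Kobayashi2003.thm22_etaSignedSelmerDual_finite_torsion)
    (h41 : Kobayashi2003.thm41_plusEtaCharIdeal_dvd)
    (hmod : hasEntireLFunction_rat) (hGZK : rank_eq_analyticRank_of_analyticRank_le_one)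
    (hS28 : bsdTriple_of_hasCM_of_L_one_ne_zero)
    (h46 : HatleyLei2019.thm46_etaSignedMu_eq_zero_iff_of_torsionIso) (hp5 : 5 ≤ p)
    (b1 b2 b3 b4 b6 : ℤ) [(⟨b1, b2, b3, b4, b6⟩ : WeierstrassCurve ℚ).IsElliptic]
    [(⟨b1, b2, b3, b4, b6⟩ : WeierstrassCurve ℚ).IsGloballyMinimal]
    (hj' : ((c4Of [b1, b2, b3, b4, b6] ^ 3 : ℤ) : ℚ) / ((discOf [b1, b2, b3, b4, b6] : ℤ) : ℚ) ∈ cmJInvariants)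
    (hr' : (⟨b1, b2, b3, b4, b6⟩ : WeierstrassCurve ℚ).analyticRank = 0) {s' : ℕ}
    (hs' : shaAn (⟨b1, b2, b3, b4, b6⟩ : WeierstrassCurve ℚ) = (s' : ℂ)) (hps' : ¬ p ∣ s')
    (W : WeierstrassCurve ℚ) [W.IsElliptic] (hr : W.analyticRank = 1)
    (V' : WeierstrassCurve ℚ) [V'.IsElliptic] [V'.IsGloballyMinimal] (C' : VariableChange ℚ)
    (hCV' : C' • (⟨b1, b2, b3, b4, b6⟩ : WeierstrassCurve ℚ).quadraticTwist ((-1) ^ (p / 2) * p) = V')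
    (hgood' : V'.HasGoodReductionAtPrime p) (hap' : V'.frobeniusTrace p = 0)
    (V : WeierstrassCurve ℚ) [V.IsElliptic] [V.IsGloballyMinimal] (C : VariableChange ℚ)
    (hCV : C • W.quadraticTwist ((-1) ^ (p / 2) * p) = V)
    (hgood : V.HasGoodReductionAtPrime p) (hap : V.frobeniusTrace p = 0) (hcong : ModPCongruent V' V p)
    (hX : ∀ {N : ℕ} [NeZero N] {f : CuspForm (Gamma0 N) 2}, IsNewformOf V f →
      ∀ (ϖ : ℚ), (if Even (p / 2) then (ϖ : ℝ) * V.realPeriodRat = plusPeriod f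
          else (ϖ : ℝ) * V.imaginaryPeriodRat = minusPeriod f) →
      ∀ (Lη : IwasawaAlgebra p), IsQuadraticBranchPlusLFunction f p ϖ Lη →
        Ideal.span {Lη} = Ideal.span {(PowerSeries.X : IwasawaAlgebra p)}) :
    QuadraticBranchPlusEtaMainConjectureAt V p :=
  EtaPrimeRoad.etaMC_r1_of_cmUnitAnchor_of_ainvs p h22 h41 hmod hGZK hS28 hp5
    (EtaCongruentAnchorByName.hHL_of_thm46 p h46 h22) b1 b2 b3 b4 b6 hj' hr' hs' hps' W hr V' C' hCV' hgood'
    hap' V C hCV hgood hap hcong hX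

end EtaPrimeRoadByName

end Summit.BirchSwinnertonDyer.BirchSwinnertonDyer.Theorems

end
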